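import Summits.HodgeConjecture.HodgeConjecture.Theorems.F0LD2ArchAdmissibleAssembly
import Literature.NumberTheory.Automorphic.Liu2021.ThetaLiftFromLineSeamFrameTransport
import Literature.NumberTheory.Automorphic.Liu2021.ThetaLiftFromLineMajorants
import Literature.NumberTheory.Weil1964.ArchDualPairThetaMajorants
import HarnessLib

-- As in the lineage (★ `ThetaLiftFromLineSeamFrameTransport`): statements over the theta-kernel datum are large; elaborate sequentially.
set_option Elab.async false

/-!
# Crux `HLiu418`, line LD1 (θ-road, organ (L-T⁺)), assembly brick 2 — the SCALAR frame transport of the seam: a strong meets in the frame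
# `diag dV` is a strong meets in the rescaled frame `diag((eē)·dV)` along a transport with the SAME matrices (rank 2, any line `⟨a⟩`)

Cell hodgecm-mathlib (D-0151), FLOOR 0; crux item `HLiu418` = stmt-HodgeConjecture-24832; half-A line LD1 (`stub_S1_facts` = #73), θ-road (LEAD «LD-R3′»
PATH Y), organ (L-T⁺) = the hypothesis `hLT` of ★ `F0LD1ThetaLinePinnedOfBricks.thetaLinePinned₂_of_bricks` (line transport of a strong meets along
locally-isometric totally-positive lines).  DEAL (LD1-plan (g0) 2026-09-02T05:13:21Z): LD1-p02 (g2) = the KIT `Liu2021/ThetaLiftFromLineSeamRescale`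
(`MeetsThetaLiftFromLine.rescale`); LA1-p01 (g2) = the ASSEMBLY `Theorems/F0LD1LineTransportOfKits`, whose kit-independent bricks are ★
`F0LD1LineClassHasse` (brick 1: `a₁·a″⁻¹ = e·ē`) and THIS file (brick 2).  THEOREMS ONLY (no `def`, no instance, no notation, no named fact, no
`sorry`); `--supports stmt-HodgeConjecture-24832`.  HC_CM is proved only modulo the 7 printed citations (2 remaining: hLiu418 = stmt-HodgeConjecture-24832,
h413 = stmt-HodgeConjecture-24833) until rung 0 closes; this file discharges nothing printed.

WHAT (step (S1) + half of (S3) of LD1-p02 (g2)'s feasibility plan 05:07:30Z).  For `e ∈ L^×` the scalar matrix `B = e·1 ∈ GL₂(L)` is a rational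
ISOMETRY `(L², diag dV) → (L², diag((ē e)·dV))`: `ᵗ(c̄B)·(1 • diag dV)·B = diag((ē e)·dV)` (§1 `formCongr_smul_one`).  ★
`MeetsThetaLiftFromLine.frameTransport` ([Liu2021, App. D §D.1 footnote l. 5215]: the seam does not see the rational frame of `V`) then carries a strong
meets in the frame `diag dV` to one in the frame `diag((ē e)·dV)` along `Ad(B⁻¹ ⊗ 1) ∘ ιA`; and since `B⁻¹ ⊗ 1` is a CENTRAL scalar adele, `Ad(B⁻¹ ⊗ 1)`
does not move a single matrix (§1 `coe_adelicIsometryConj_aOfB_of_smul_one`): the new transport has the same values in `GL₂(𝔸_L)` as `ιA` (the two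
unitary groups `U(diag dV)(𝔸) = U(diag((ē e)·dV))(𝔸)` coincide as sets).  §2 supplies, at rank 2, the Weil MAJORANTS of the rescaled frame from the
curve letters' definiteness binder alone (`hasThetaMajorants_lineThetaKernelDatum₂`: at `ι` the sign fact `h₁V` is vacuous-but-one — `dV 1 ∈ L⁺ ∖ 0` is a
non-zero real through `ι` — and off `ι` definiteness gives positive signs) and the definiteness ∕ compactness of the rescaled frame
(`posDef_map_diagonal_smul_norm`, ★ `compactSpace_quotient_diagonal_of_posDef`); §3 is the transport `MeetsThetaLiftFromLine.smulFrameTransport₂`.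

## References
* [Liu2021] Y. Liu, Camb. J. Math. 9 (2021) = arXiv:2102.11518, Def. 4.11 (l. 2092–2096); App. D §D.1 Step 1 footnote (l. 5215), Step 2 (l. 5219).
* [Weil1964] A. Weil, Acta Math. 111 (1964), Chap. III n° 41 Lemme 5 (p. 194), Thm. 6 (p. 193).
* [PlatonovRapinchuk1994] V. Platonov, A. Rapinchuk, *Algebraic Groups and Number Theory* (1994), §2.3, §5.1, §5.3 Thm. 5.5.
* [Kudla1994] S. Kudla, Israel J. Math. 87 (1994), Thm. 3.1.
-/

set_option autoImplicit false
-- the mandated namespace has the single-problem summit's repeated segment (`HodgeConjecture.HodgeConjecture`)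
set_option linter.dupNamespace false

noncomputable section

open NumberField NumberField.InfinitePlace MeasureTheory IsDedekindDomain
open scoped Matrix ComplexOrder ENNReal Classical
open Literature.NumberTheory.Automorphic Literature.NumberTheory.Automorphic.UnitaryGroup
open Literature.NumberTheory.Automorphic.IdeleClassGroup
open Literature.NumberTheory.Automorphic.Liu2021
open Literature.NumberTheory.Automorphic.Liu2021.Def411WeilCarriers
open Literature.NumberTheory.Automorphic.Liu2021.Def411WeilCarriersDoubling
open Literature.NumberTheory.GelbartRogawski1991 Literature.NumberTheory.GelbartRogawski1991.UnitaryDualPair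
open Literature.NumberTheory.GelbartRogawski1991.GRConstruction
open Literature.NumberTheory.Weil1964
open Literature.RepresentationTheory.Liu2021

namespace Summit.HodgeConjecture.HodgeConjecture.Cruxes.HLiu418.F0LD1ScalarFrameTransport

/-! ## §1 The scalar isometry `B = e·1` and the triviality of `Ad(B⁻¹ ⊗ 1)` on matrices -/

section Scalar

variable (L : Type) [Field L] [NumberField L] [IsCMField L] {N : ℕ}

/-- **`ᵗ(c̄(e·1)) · (1 • diag dV) · (e·1) = diag((ē e)·dV)`**: the scalar matrix `B = e·1` is a rational isometry from the frame `diag dV` to the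
rescaled frame (the socket form `hB` of ★ `MeetsThetaLiftFromLine.frameTransport`). [cite: PlatonovRapinchuk1994, §2.3] -/
theorem formCongr_smul_one (e : L) (B : GL (Fin N) L) (hB : (B : Matrix (Fin N) (Fin N) L) = e • (1 : Matrix (Fin N) (Fin N) L))
    (dV : Fin N → L) :
    formCongr ((IsCMField.complexConj L : L ≃ₐ[Fp L] L) : L →+* L) B ((1 : L) • Matrix.diagonal dV) =
      Matrix.diagonal (fun i => (IsCMField.complexConj L e * e) * dV i) := by
  rw [formCongr, hB, one_smul, Matrix.map_smul' _ _ _ (map_mul _), Matrix.map_one _ (map_zero _) (map_one _), Matrix.transpose_smul,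
    Matrix.transpose_one, Matrix.smul_mul, Matrix.one_mul, Matrix.mul_smul, Matrix.mul_one, smul_smul, ← Matrix.diagonal_smul]
  congr 1
  funext i
  rw [Pi.smul_apply, smul_eq_mul, mul_comm e]
  rfl

/-- **`Ad(B⁻¹ ⊗ 1)` IS THE IDENTITY ON MATRICES for a scalar `B = e·1`**: the adelic isometry `aOfB L B = B⁻¹ ⊗ 1 = e⁻¹·1` is central in
`GL_N(𝔸_L)`, so `u ↦ (B⁻¹ ⊗ 1) u (B ⊗ 1)` does not move a single matrix — the transport ★ `adelicIsometryConj … (aOfB L B) …` between the two (equal, as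
sets of matrices) unitary groups `U(diag dV')(𝔸)` and `U(diag dV)(𝔸)` has the same values in `GL_N(𝔸_L)` as the identity. [cite: PlatonovRapinchuk1994, §5.1] -/
theorem coe_adelicIsometryConj_aOfB_of_smul_one (e : L) (B : GL (Fin N) L)
    (hB : (B : Matrix (Fin N) (Fin N) L) = e • (1 : Matrix (Fin N) (Fin N) L))
    (hBinv : ((B⁻¹ : GL (Fin N) L) : Matrix (Fin N) (Fin N) L) = e⁻¹ • (1 : Matrix (Fin N) (Fin N) L))
    {dV dV' : Fin N → L}
    (hiso : (((aOfB L B : GL (Fin N) (AdeleRing (𝓞 L) L)) : Matrix (Fin N) (Fin N) (AdeleRing (𝓞 L) L)).map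
        (conjAdele (Fp L) L (IsCMField.complexConj L)))ᵀ * adelicForm L N (Matrix.diagonal dV) * (aOfB L B : GL (Fin N) (AdeleRing (𝓞 L) L)) =
      adelicForm L N (Matrix.diagonal dV'))
    (he : e ≠ 0) (u : UnitaryGroup.adelic (Fp L) L (IsCMField.complexConj L) N (Matrix.diagonal dV')) :
    ((adelicIsometryConj (Fp L) L (IsCMField.complexConj L) N (aOfB L B) hiso u :
        UnitaryGroup.adelic (Fp L) L (IsCMField.complexConj L) N (Matrix.diagonal dV)) : GL (Fin N) (AdeleRing (𝓞 L) L)) =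
      (u : GL (Fin N) (AdeleRing (𝓞 L) L)) := by
  rw [coe_adelicIsometryConj]
  apply Units.ext
  have hinv : ((aOfB L B)⁻¹ : GL (Fin N) (AdeleRing (𝓞 L) L)) = Matrix.GeneralLinearGroup.map (algebraMap L (AdeleRing (𝓞 L) L)) B := by
    rw [aOfB, map_inv, inv_inv]
  have hmapB : ((Matrix.GeneralLinearGroup.map (algebraMap L (AdeleRing (𝓞 L) L)) B : GL (Fin N) (AdeleRing (𝓞 L) L)) :
      Matrix (Fin N) (Fin N) (AdeleRing (𝓞 L) L)) = (B : Matrix (Fin N) (Fin N) L).map (algebraMap L (AdeleRing (𝓞 L) L)) := rfl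
  rw [Units.val_mul, Units.val_mul, hinv, coe_aOfB, hBinv, hmapB, hB,
    Matrix.map_smul' _ _ _ (map_mul _), Matrix.map_smul' _ _ _ (map_mul _), Matrix.map_one _ (map_zero _) (map_one _),
    Matrix.smul_mul, Matrix.one_mul, Matrix.mul_smul, Matrix.mul_one, smul_smul, ← map_mul, mul_inv_cancel₀ he, map_one, one_smul]

end Scalar

/-! ## §2 Rank 2: Weil majorants, definiteness and compactness of a (rescaled) real diagonal frame from the curve letters' binders -/

section RankTwo

variable (L : Type) [Field L] [NumberField L] [IsCMField L] (ι : L →+* ℂ) {n' : ℕ} (e₁ : Fin 2 × Fin 1 ≃ Fin n')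
  (dV : Fin 2 → L) (hdV : ∀ i, IsCMField.complexConj L (dV i) = dV i) (hdV0 : ∀ i, dV i ≠ 0)

/-- **Weil MAJORANTS of the line's theta kernel at rank 2 from DEFINITENESS OFF `ι` alone** (the literal `hρ` of ★ `lineThetaKernelDatum L 2 e₁ dV …`):
★ `hasThetaMajorants_lineThetaKernelDatum` at the sign facts `h₁V` (with `i₀ := 0` the only other index is `1`, and `ι(dV 1)` is a NON-ZERO REAL, ★
`re_apply_ne_zero_of_complexConj_eq`) and `hV` (positive signs from the positive definiteness of `(diag dV)^{τ′}`, Mathlib `Matrix.posDef_diagonal_iff`).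
[cite: Weil1964, Chap. III n° 41 Lemme 5 p. 194, Thm. 6 (1) p. 193] [cite: Liu2021, App. D §D.1 Steps 1–2 (l. 5215–5219)] -/
theorem hasThetaMajorants_lineThetaKernelDatum₂
    (hdef : ∀ τ' : L →+* ℂ, InfinitePlace.mk τ' ≠ InfinitePlace.mk ι → ((Matrix.diagonal dV).map τ').PosDef)
    (μ : Literature.NumberTheory.Automorphic.IdeleClassGroup L →ₜ* Circle) (hμ : IsConjugateSymplectic L μ) (a : (↥(maximalRealSubfield L))ˣ) :
    HasThetaMajorants fun
      (p : ↥(UnitaryGroup.adelic (↥(maximalRealSubfield L)) L (IsCMField.complexConj L) 2 (Matrix.diagonal dV)) ×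
        ↥(UnitaryGroup.adelic (↥(maximalRealSubfield L)) L (IsCMField.complexConj L) 1 (JW (↥(maximalRealSubfield L)) L a)))
      (Φ : piSchwartzBruhat (↥(maximalRealSubfield L)) (Fin n')) =>
        pairRep (↥(maximalRealSubfield L)) L (IsCMField.complexConj L) 2 1 e₁ (Matrix.diagonal dV) (JW (↥(maximalRealSubfield L)) L a)
          (chiSplittingLine L e₁ dV hdV hdV0 (toHeckeCharacter L μ) (isUnitary_toHeckeCharacter L μ)
            ((isOscillatorChar_toHeckeCharacter_iff μ).mpr hμ) (TW (↥(maximalRealSubfield L)) a)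
            (isUnit_det_TW (↥(maximalRealSubfield L)) a) (JW (↥(maximalRealSubfield L)) L a) (JW_eq (↥(maximalRealSubfield L)) L a)) p Φ := by
  refine hasThetaMajorants_lineThetaKernelDatum L e₁ dV hdV hdV0 μ hμ a ι ⟨0, ?_⟩ fun τ hτ => Or.inl fun i => ?_
  · have hne := re_apply_ne_zero_of_complexConj_eq L ι (hdV 1) (hdV0 1)
    rcases lt_or_gt_of_ne hne with hneg | hpos
    · exact Or.inr fun i hi => by
        obtain rfl : i = 1 := by fin_cases i <;> simp_all
        exact hneg
    · exact Or.inl fun i hi => by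
        obtain rfl : i = 1 := by fin_cases i <;> simp_all
        exact hpos
  · have h2 := hdef τ hτ
    rw [Matrix.diagonal_map (map_zero _)] at h2
    exact (Complex.pos_iff.1 ((Matrix.posDef_diagonal_iff.1 h2) i)).1

variable (e : L) (he : e ≠ 0)

include hdV in
/-- the rescaled frame is real: `c̄((ē e)·dV i) = (ē e)·dV i`. [folklore] -/
theorem complexConj_smul_frame (i : Fin 2) :
    IsCMField.complexConj L ((IsCMField.complexConj L e * e) * dV i) = (IsCMField.complexConj L e * e) * dV i := by
  rw [map_mul, map_mul, IsCMField.complexConj_apply_apply, hdV, mul_comm e]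

include he hdV0 in
/-- the rescaled frame is non-degenerate. [folklore] -/
theorem smul_frame_ne_zero (i : Fin 2) : (IsCMField.complexConj L e * e) * dV i ≠ 0 :=
  mul_ne_zero (mul_ne_zero ((map_ne_zero _).2 he) he) (hdV0 i)

include he in
/-- **the rescaled frame is still positive definite off `ι`**: `τ′(ē e) = |τ′ e|² > 0`. [cite: PlatonovRapinchuk1994, §5.3 Thm. 5.5] -/
theorem posDef_map_diagonal_smul_frame
    (hdef : ∀ τ' : L →+* ℂ, InfinitePlace.mk τ' ≠ InfinitePlace.mk ι → ((Matrix.diagonal dV).map τ').PosDef)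
    (τ' : L →+* ℂ) (hτ' : InfinitePlace.mk τ' ≠ InfinitePlace.mk ι) :
    ((Matrix.diagonal fun i => (IsCMField.complexConj L e * e) * dV i).map τ').PosDef := by
  have h2 := hdef τ' hτ'
  rw [Matrix.diagonal_map (map_zero _)] at h2 ⊢
  rw [Matrix.posDef_diagonal_iff] at h2 ⊢
  intro i
  have hc : τ' (IsCMField.complexConj L e * e) = ((Complex.normSq (τ' e) : ℝ) : ℂ) := by
    rw [map_mul, show τ' (IsCMField.complexConj L e) = starRingEnd ℂ (τ' e) from IsCMField.complexEmbedding_complexConj L τ' e,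
      Complex.normSq_eq_conj_mul_self]
  have hpos : (0 : ℝ) < Complex.normSq (τ' e) := Complex.normSq_pos.2 ((map_ne_zero _).2 he)
  have h2i : 0 < τ' (dV i) := h2 i
  show 0 < τ' ((IsCMField.complexConj L e * e) * dV i)
  rw [map_mul, hc]
  exact mul_pos (Complex.zero_lt_real.2 hpos) h2i

include he in
/-- **`[U(diag((ē e)·dV))]` is compact** (definite off `ι`, `[L:ℚ] ≥ 4`; ★ `compactSpace_quotient_diagonal_of_posDef`). [cite: PlatonovRapinchuk1994, §5.3 Thm. 5.5] -/
theorem compactSpace_quotient_smul_frame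
    (hdef : ∀ τ' : L →+* ℂ, InfinitePlace.mk τ' ≠ InfinitePlace.mk ι → ((Matrix.diagonal dV).map τ').PosDef)
    (h4 : 4 ≤ Module.finrank ℚ L) :
    CompactSpace (↥(UnitaryGroup.adelic (↥(maximalRealSubfield L)) L (IsCMField.complexConj L) 2
        (Matrix.diagonal fun i => (IsCMField.complexConj L e * e) * dV i)) ⧸
      (UnitaryGroup.toAdelic (↥(maximalRealSubfield L)) L (IsCMField.complexConj L) 2
        (Matrix.diagonal fun i => (IsCMField.complexConj L e * e) * dV i)).range) :=
  F0LD2ArchAdmissibleAssembly.compactSpace_quotient_diagonal_of_posDef L 2 _ ι (posDef_map_diagonal_smul_frame L ι dV e he hdef) h4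

end RankTwo

/-! ## §3 The scalar frame transport of a strong meets (rank 2) -/

section Transport

variable (L : Type) [Field L] [NumberField L] [IsCMField L] (ι : L →+* ℂ) (H : Matrix (Fin 2) (Fin 2) L)
  {n' : ℕ} (e₁ : Fin 2 × Fin 1 ≃ Fin n') (dV : Fin 2 → L) (hdV : ∀ i, IsCMField.complexConj L (dV i) = dV i) (hdV0 : ∀ i, dV i ≠ 0)
  (hdef : ∀ τ' : L →+* ℂ, InfinitePlace.mk τ' ≠ InfinitePlace.mk ι → ((Matrix.diagonal dV).map τ').PosDef)
  {μA : Measure (adelicGroupData (↥(maximalRealSubfield L)) L (IsCMField.complexConj L) 2 H).automorphicQuotient}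
  [(adelicGroupData (↥(maximalRealSubfield L)) L (IsCMField.complexConj L) 2 H).IsAutomorphicMeasure μA]
  (μ : Literature.NumberTheory.Automorphic.IdeleClassGroup L →ₜ* Circle) (hμ : IsConjugateSymplectic L μ) (a : (↥(maximalRealSubfield L))ˣ)
  (e : L) (he : e ≠ 0)

omit [NumberField L] [IsCMField L] in
/-- the scalar `e·1 ∈ GL₂(L)` has matrix `e • 1`. [folklore] -/
theorem coe_scalarGL :
    ((Units.map ((Matrix.scalar (Fin 2) : L →+* Matrix (Fin 2) (Fin 2) L) : L →* Matrix (Fin 2) (Fin 2) L) (Units.mk0 e he) :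
        GL (Fin 2) L) : Matrix (Fin 2) (Fin 2) L) = e • (1 : Matrix (Fin 2) (Fin 2) L) := by
  rw [Units.coe_map, MonoidHom.coe_coe, Matrix.scalar_apply, Units.val_mk0, Matrix.smul_one_eq_diagonal]

omit [NumberField L] [IsCMField L] in
/-- its inverse has matrix `e⁻¹ • 1`. [folklore] -/
theorem coe_scalarGL_inv :
    (((Units.map ((Matrix.scalar (Fin 2) : L →+* Matrix (Fin 2) (Fin 2) L) : L →* Matrix (Fin 2) (Fin 2) L) (Units.mk0 e he))⁻¹ :
        GL (Fin 2) L) : Matrix (Fin 2) (Fin 2) L) = e⁻¹ • (1 : Matrix (Fin 2) (Fin 2) L) := by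
  rw [← map_inv, Units.coe_map, MonoidHom.coe_coe, Matrix.scalar_apply, Units.val_inv_eq_inv_val, Units.val_mk0, Matrix.smul_one_eq_diagonal]

/-- the socket form `hB` of ★ `frameTransport` for the scalar isometry. [cite: PlatonovRapinchuk1994, §2.3] -/
theorem formCongr_scalarGL :
    formCongr ((IsCMField.complexConj L : L ≃ₐ[Fp L] L) : L →+* L)
        (Units.map ((Matrix.scalar (Fin 2) : L →+* Matrix (Fin 2) (Fin 2) L) : L →* Matrix (Fin 2) (Fin 2) L) (Units.mk0 e he))
        ((1 : L) • Matrix.diagonal dV) =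
      Matrix.diagonal (fun i => (IsCMField.complexConj L e * e) * dV i) :=
  formCongr_smul_one L e _ (coe_scalarGL L e he) dV

include hdef in
/-- **THE SCALAR FRAME TRANSPORT OF A STRONG MEETS (rank 2)**: if the discrete `P` of `U(H)` meets the theta lift from the line `⟨a⟩` in the frame
`diag dV` along `ιA`, then — for every `e ∈ L^×` — it meets it in the rescaled frame `diag((ē e)·dV)` along `Ad((e·1)⁻¹ ⊗ 1) ∘ ιA`, a transport
with the SAME values in `GL₂(𝔸_L)` as `ιA` (`coe_adelicIsometryConj_aOfB_of_smul_one`).  ★ `MeetsThetaLiftFromLine.frameTransport` at the scalar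
isometry `B = e·1` (`formCongr_scalarGL`), the majorants of the rescaled frame being `hasThetaMajorants_lineThetaKernelDatum₂` at its definiteness
`posDef_map_diagonal_smul_frame`. [cite: Liu2021, App. D §D.1 Step 1 footnote (l. 5215), Step 2 (l. 5219)] [cite: Kudla1994, Thm. 3.1]
[cite: Weil1964, Chap. III n° 41 Thm 6 p. 193] -/
theorem MeetsThetaLiftFromLine.smulFrameTransport₂
    [CompactSpace (↥(UnitaryGroup.adelic (↥(maximalRealSubfield L)) L (IsCMField.complexConj L) 2 (Matrix.diagonal dV)) ⧸
      (UnitaryGroup.toAdelic (↥(maximalRealSubfield L)) L (IsCMField.complexConj L) 2 (Matrix.diagonal dV)).range)]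
    [CompactSpace (↥(UnitaryGroup.adelic (↥(maximalRealSubfield L)) L (IsCMField.complexConj L) 2
        (Matrix.diagonal fun i => (IsCMField.complexConj L e * e) * dV i)) ⧸
      (UnitaryGroup.toAdelic (↥(maximalRealSubfield L)) L (IsCMField.complexConj L) 2
        (Matrix.diagonal fun i => (IsCMField.complexConj L e * e) * dV i)).range)]
    (P : DiscreteAutomorphicRep (adelicGroupData (↥(maximalRealSubfield L)) L (IsCMField.complexConj L) 2 H) μA)
    (ιA : (adelicGroupData (↥(maximalRealSubfield L)) L (IsCMField.complexConj L) 2 H).Adelic →*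
      ↥(UnitaryGroup.adelic (↥(maximalRealSubfield L)) L (IsCMField.complexConj L) 2 (Matrix.diagonal dV)))
    (h : MeetsThetaLiftFromLine L 2 H e₁ dV hdV hdV0 P μ hμ a ιA) :
    MeetsThetaLiftFromLine L 2 H e₁ (fun i => (IsCMField.complexConj L e * e) * dV i) (complexConj_smul_frame L dV hdV e)
      (smul_frame_ne_zero L dV hdV0 e he) P μ hμ a
      ((adelicIsometryConj (Fp L) L (IsCMField.complexConj L) 2
          (aOfB L (Units.map ((Matrix.scalar (Fin 2) : L →+* Matrix (Fin 2) (Fin 2) L) : L →* Matrix (Fin 2) (Fin 2) L) (Units.mk0 e he)))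
          (aOfB_isometry L (fun i => (IsCMField.complexConj L e * e) * dV i) dV _ (formCongr_scalarGL L dV e he))).comp ιA) :=
  MeetsThetaLiftFromLine.frameTransport L 2 H e₁ dV hdV hdV0 (fun i => (IsCMField.complexConj L e * e) * dV i)
    (complexConj_smul_frame L dV hdV e) (smul_frame_ne_zero L dV hdV0 e he) μ hμ a _ (formCongr_scalarGL L dV e he)
    (hasThetaMajorants_lineThetaKernelDatum₂ L ι e₁ _ (complexConj_smul_frame L dV hdV e) (smul_frame_ne_zero L dV hdV0 e he)
      (posDef_map_diagonal_smul_frame L ι dV e he hdef) μ hμ a) P ιA h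

/-- the transported seam has the SAME matrices as `ιA`. [cite: PlatonovRapinchuk1994, §5.1] -/
theorem coe_smulFrameTransport₂_apply
    (ιA : (adelicGroupData (↥(maximalRealSubfield L)) L (IsCMField.complexConj L) 2 H).Adelic →*
      ↥(UnitaryGroup.adelic (↥(maximalRealSubfield L)) L (IsCMField.complexConj L) 2 (Matrix.diagonal dV)))
    (k : (adelicGroupData (↥(maximalRealSubfield L)) L (IsCMField.complexConj L) 2 H).Adelic) :
    ((((adelicIsometryConj (Fp L) L (IsCMField.complexConj L) 2
          (aOfB L (Units.map ((Matrix.scalar (Fin 2) : L →+* Matrix (Fin 2) (Fin 2) L) : L →* Matrix (Fin 2) (Fin 2) L) (Units.mk0 e he)))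
          (aOfB_isometry L (fun i => (IsCMField.complexConj L e * e) * dV i) dV _ (formCongr_scalarGL L dV e he))).comp ιA) k :
        ↥(UnitaryGroup.adelic (↥(maximalRealSubfield L)) L (IsCMField.complexConj L) 2
          (Matrix.diagonal fun i => (IsCMField.complexConj L e * e) * dV i))) : GL (Fin 2) (AdeleRing (𝓞 L) L)) =
      ((ιA k : ↥(UnitaryGroup.adelic (↥(maximalRealSubfield L)) L (IsCMField.complexConj L) 2 (Matrix.diagonal dV))) :
        GL (Fin 2) (AdeleRing (𝓞 L) L)) := by
  rw [MonoidHom.comp_apply]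
  exact coe_adelicIsometryConj_aOfB_of_smul_one L e _ (coe_scalarGL L e he) (coe_scalarGL_inv L e he) _ he (ιA k)

end Transport

end Summit.HodgeConjecture.HodgeConjecture.Cruxes.HLiu418.F0LD1ScalarFrameTransport

end
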